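import Literature.Analysis.Complex.AnalyticCover
import Literature.Analysis.Complex.BranchedCoveringCharPolySCV
import HarnessLib

/-!
# Fibres of the projection of an affine hypersurface along a monic direction

Layer `Literature/Analysis/Complex`. Setting of Serre's algebraisation lemma on an affine hypersurface (GAGA n° 19–20,
SGA 1 XII 5.1): `h ∈ ℂ[z₀, …, z_m]` is read as a polynomial `P = Σ_j a_j(w) z₀^j` in `t = z₀` with coefficients
`a_j ∈ ℂ[w]`, `w = (z₁, …, z_m)` (`MvPolynomial.finSuccEquiv`), MONIC OF DEGREE `d` IN `t` up to the constant `c ≠ 0`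
(`P.coeff d = C c`, `P.natDegree ≤ d`) with `deg a_j ≤ d - j` (so `h` has total degree `≤ d`). Then the projection
`(t, w) ↦ w` restricted to the hypersurface `U = {h = 0}` is a finite branched covering of `ℂ^m` of degree `d`, and this
file records its elementary analytic structure, in the language of the tree's `WeierstrassData` / `sliceRoots`
(`Literature/Analysis/Complex/WeierstrassPreparation`, `AnalyticCover`):

* `norm_eval_le_of_totalDegree_le` — `|a(w)| ≤ C (1 + |w|)^e` for `a ∈ ℂ[w]` of total degree `≤ e`;
* `norm_root_le` — **the fibres are uniformly bounded**: every root `t` of `P_w = P(·, w)` has `|t| ≤ L (1 + |w|)`;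
* `differentiable_fibrePoly_eval` — `(w, t) ↦ P_w(t) = h(t, w)` is holomorphic on `ℂ^m × ℂ`;
* `weierstrassData_fibre` — on `|w - w₀| < 1` the family `P_w` is zero-free on the circle `|t| = L (2 + |w₀|) + 1`
  (the tree's standing hypotheses `WeierstrassData`), and `sliceRoots_fibre_eq_roots` — the roots it counts in that
  disc, with multiplicity, are ALL the roots: `sliceRoots = P_w.roots`;

The splitting of the roots of `P_w`, `w` near `w₀`, into clusters around the roots of `P_{w₀}` is in the sequel
`AffineHypersurfaceFibreClusters`.

Everything is proved; no definitions, no named facts.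

## References

* J.-P. Serre, *Géométrie algébrique et géométrie analytique*, Ann. Inst. Fourier 6 (1956), n° 19 Lemme 8, n° 20. [SerreGAGA1956]
* E. M. Chirka, *Complex Analytic Sets* (1989), §1.1–1.3 (roots depending on parameters). [Chirka1989]
-/

noncomputable section

open Polynomial Complex Metric Set Filter Finset
open scoped Topology

namespace Literature.Analysis.Complex

namespace AffineHypersurface

open SCV

variable {m : ℕ}

/-! ### Growth of polynomial coefficients -/

/-- **Polynomial growth with the total degree as exponent**: for `a ∈ ℂ[w₁, …, w_m]` of total degree `≤ e`,
`|a(w)| ≤ C (1 + |w|)^e` for all `w` (sup norm). [cite: SerreGAGA1956, n° 19 Lemme 8] -/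
theorem norm_eval_le_of_totalDegree_le (a : MvPolynomial (Fin m) ℂ) {e : ℕ} (ha : a.totalDegree ≤ e) :
    ∃ C : ℝ, 0 ≤ C ∧ ∀ w : Fin m → ℂ, ‖MvPolynomial.eval w a‖ ≤ C * (1 + ‖w‖) ^ e := by
  classical
  refine ⟨∑ s ∈ a.support, ‖a.coeff s‖, sum_nonneg fun _ _ ↦ norm_nonneg _, fun w ↦ ?_⟩
  rw [MvPolynomial.eval_eq, sum_mul]
  refine (norm_sum_le _ _).trans (sum_le_sum fun s hs ↦ ?_)
  rw [norm_mul, norm_prod]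
  refine mul_le_mul_of_nonneg_left ?_ (norm_nonneg _)
  have h1 : ∀ i, ‖w i ^ s i‖ ≤ (1 + ‖w‖) ^ s i := fun i ↦ by
    rw [norm_pow]
    exact pow_le_pow_left₀ (norm_nonneg _) ((norm_le_pi_norm w i).trans (by linarith [norm_nonneg w])) _
  calc ∏ i ∈ s.support, ‖w i ^ s i‖ ≤ ∏ i ∈ s.support, (1 + ‖w‖) ^ s i :=
        prod_le_prod (fun _ _ ↦ norm_nonneg _) fun i _ ↦ h1 i
    _ = (1 + ‖w‖) ^ ∑ i ∈ s.support, s i := (prod_pow_eq_pow_sum _ _ _)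
    _ ≤ (1 + ‖w‖) ^ e := by
        refine pow_le_pow_right₀ (by linarith [norm_nonneg w]) ?_
        rw [← Finsupp.degree_apply]
        exact (MvPolynomial.le_totalDegree hs).trans ha


/-! ### The fibre polynomials `P_w` -/

section Fibre

variable {d : ℕ} {c : ℂ} (P : Polynomial (MvPolynomial (Fin m) ℂ))

/-- The fibre polynomial `P_w = Σ_j a_j(w) X^j` has degree `≤ d` when `P` has. [cite: SerreGAGA1956, n° 19 Lemme 8] -/
theorem natDegree_map_eval_le (hPd : P.natDegree ≤ d) (w : Fin m → ℂ) :
    (P.map (MvPolynomial.eval w)).natDegree ≤ d :=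
  (natDegree_map_le).trans hPd

/-- The fibre polynomial has leading term `c X^d`: `P_w.coeff d = c`. [cite: SerreGAGA1956, n° 19 Lemme 8] -/
theorem coeff_map_eval_eq (hPlead : P.coeff d = MvPolynomial.C c) (w : Fin m → ℂ) :
    (P.map (MvPolynomial.eval w)).coeff d = c := by
  rw [coeff_map, hPlead, MvPolynomial.eval_C]

/-- The fibre polynomial has degree exactly `d` and leading coefficient `c ≠ 0`. [cite: SerreGAGA1956, n° 19 Lemme 8] -/
theorem natDegree_map_eval_eq (hc : c ≠ 0) (hPd : P.natDegree ≤ d) (hPlead : P.coeff d = MvPolynomial.C c)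
    (w : Fin m → ℂ) :
    (P.map (MvPolynomial.eval w)).natDegree = d ∧ (P.map (MvPolynomial.eval w)).leadingCoeff = c := by
  have h1 := natDegree_map_eval_le P hPd w
  have h2 := coeff_map_eval_eq P hPlead w
  have h3 : (P.map (MvPolynomial.eval w)).natDegree = d :=
    le_antisymm h1 (le_natDegree_of_ne_zero (by rw [h2]; exact hc))
  exact ⟨h3, by rw [leadingCoeff, h3, h2]⟩

/-- The fibre polynomial is non-zero. [cite: SerreGAGA1956, n° 19 Lemme 8] -/
theorem map_eval_ne_zero (hc : c ≠ 0) (hPlead : P.coeff d = MvPolynomial.C c) (w : Fin m → ℂ) :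
    P.map (MvPolynomial.eval w) ≠ 0 := fun h0 ↦ by
  have := coeff_map_eval_eq P hPlead w
  rw [h0, coeff_zero] at this
  exact hc this.symm

/-- The fibre polynomial has exactly `d` roots counted with multiplicity. [cite: SerreGAGA1956, n° 19 Lemme 8] -/
theorem card_roots_map_eval (hc : c ≠ 0) (hPd : P.natDegree ≤ d) (hPlead : P.coeff d = MvPolynomial.C c)
    (w : Fin m → ℂ) : Multiset.card (P.map (MvPolynomial.eval w)).roots = d := by
  rw [← (natDegree_map_eval_eq P hc hPd hPlead w).1]
  exact ((IsAlgClosed.splits _).natDegree_eq_card_roots).symm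

/-- **Evaluation of the fibre polynomial as a product over its roots**:
`P_w(t) = c ∏_{ρ} (t - ρ)`. [cite: SerreGAGA1956, n° 19 Lemme 8] -/
theorem eval_map_eval_eq_prod (hc : c ≠ 0) (hPd : P.natDegree ≤ d) (hPlead : P.coeff d = MvPolynomial.C c)
    (w : Fin m → ℂ) (t : ℂ) :
    (P.map (MvPolynomial.eval w)).eval t = c * ((P.map (MvPolynomial.eval w)).roots.map (t - ·)).prod := by
  obtain ⟨hdeg, hlc⟩ := natDegree_map_eval_eq P hc hPd hPlead w
  have hsplit := C_leadingCoeff_mul_prod_multiset_X_sub_C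
    ((card_roots_map_eval P hc hPd hPlead w).trans hdeg.symm)
  conv_lhs => rw [← hsplit]
  rw [eval_mul, eval_C, hlc, eval_multiset_prod, Multiset.map_map]
  congr 2
  refine Multiset.map_congr rfl fun a _ ↦ ?_
  simp

/-! ### Growth: the roots are bounded linearly in `|w|` -/

/-- **Bound for the roots of the fibres**: if `deg a_j ≤ d - j` for the coefficients of `P` (`P.coeff d = c ≠ 0`),
then every root `t` of `P_w` satisfies `|t| ≤ L (1 + |w|)` for a constant `L` depending only on `P`: from
`c t^d = -Σ_{j<d} a_j(w) t^j` and `|a_j(w)| ≤ C_j (1 + |w|)^{d-j}`, if `|t| ≥ L (1 + |w|)` with `L |c| > Σ C_j` then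
`|c| |t|^d ≤ Σ_j C_j (1+|w|)^{d-j} |t|^j < |c| |t|^d`. (Properness of the projection of the hypersurface along a
monic direction.) [cite: SerreGAGA1956, n° 19 Lemme 8] -/
theorem exists_norm_root_le (hc : c ≠ 0) (hPd : P.natDegree ≤ d) (hPlead : P.coeff d = MvPolynomial.C c)
    (hPcoef : ∀ j, (P.coeff j).totalDegree + j ≤ d) :
    ∃ L : ℝ, 1 ≤ L ∧ ∀ (w : Fin m → ℂ) (t : ℂ), (P.map (MvPolynomial.eval w)).IsRoot t → ‖t‖ ≤ L * (1 + ‖w‖) := by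
  classical
  -- coefficient bounds
  have hC : ∀ j, ∃ C : ℝ, 0 ≤ C ∧ ∀ w : Fin m → ℂ,
      ‖MvPolynomial.eval w (P.coeff j)‖ ≤ C * (1 + ‖w‖) ^ (d - j) := fun j ↦
    norm_eval_le_of_totalDegree_le (P.coeff j) (by have := hPcoef j; omega)
  choose C hC0 hC using hC
  set L : ℝ := 1 + (∑ j ∈ range d, C j) / ‖c‖ with hL
  have hcpos : 0 < ‖c‖ := norm_pos_iff.mpr hc
  have hL1 : 1 ≤ L := by rw [hL]; exact le_add_of_nonneg_right (div_nonneg (sum_nonneg fun j _ ↦ hC0 j) hcpos.le)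
  refine ⟨L, hL1, fun w t ht ↦ ?_⟩
  by_contra hlt
  push Not at hlt
  set A : ℝ := 1 + ‖w‖ with hA
  have hA1 : 1 ≤ A := by rw [hA]; linarith [norm_nonneg w]
  have hApos : 0 < A := by linarith
  have htpos : 0 < ‖t‖ := lt_of_le_of_lt (by positivity) hlt
  have hAt : A ≤ ‖t‖ := le_trans (by nlinarith) hlt.le
  -- the equation `c t^d = - Σ_{j<d} a_j t^j`
  have hroot : (P.map (MvPolynomial.eval w)).eval t = 0 := ht
  rw [eval_eq_sum_range' (lt_of_le_of_lt (natDegree_map_eval_le P hPd w) (Nat.lt_succ_self d)),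
    sum_range_succ, coeff_map_eval_eq P hPlead w] at hroot
  have heq : c * t ^ d = -∑ j ∈ range d, (P.map (MvPolynomial.eval w)).coeff j * t ^ j :=
    eq_neg_of_add_eq_zero_right hroot
  -- estimate the right side
  have hest : ‖c‖ * ‖t‖ ^ d ≤ (∑ j ∈ range d, C j) * A ^ 1 * ‖t‖ ^ (d - 1) * 1 := by
    have h1 : ‖c * t ^ d‖ ≤ ∑ j ∈ range d, C j * A ^ (d - j) * ‖t‖ ^ j := by
      rw [heq, norm_neg]
      refine (norm_sum_le _ _).trans (sum_le_sum fun j hj ↦ ?_)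
      rw [norm_mul, norm_pow, coeff_map]
      exact mul_le_mul_of_nonneg_right (hC j w) (by positivity)
    rw [norm_mul, norm_pow] at h1
    refine h1.trans ?_
    rw [mul_one, pow_one, sum_mul, sum_mul]
    refine sum_le_sum fun j hj ↦ ?_
    have hjd : j < d := Finset.mem_range.mp hj
    -- `A^{d-j} |t|^j ≤ A |t|^{d-1}` since `A ≤ |t|`
    have key : A ^ (d - j) * ‖t‖ ^ j ≤ A * ‖t‖ ^ (d - 1) := by
      have e1 : A ^ (d - j) = A * A ^ (d - j - 1) := by
        rw [← pow_succ']; congr 1; omega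
      rw [e1, mul_assoc]
      refine mul_le_mul_of_nonneg_left ?_ hApos.le
      calc A ^ (d - j - 1) * ‖t‖ ^ j ≤ ‖t‖ ^ (d - j - 1) * ‖t‖ ^ j :=
            mul_le_mul_of_nonneg_right (pow_le_pow_left₀ hApos.le hAt _) (by positivity)
        _ = ‖t‖ ^ (d - 1) := by rw [← pow_add]; congr 1; omega
    calc C j * A ^ (d - j) * ‖t‖ ^ j = C j * (A ^ (d - j) * ‖t‖ ^ j) := by ring
      _ ≤ C j * (A * ‖t‖ ^ (d - 1)) := mul_le_mul_of_nonneg_left key (hC0 j)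
      _ = C j * A * ‖t‖ ^ (d - 1) := by ring
  -- but `|t| ≥ L A > (Σ C_j / |c|) A`
  have hd0 : 0 < d := by
    by_contra hd0
    have : d = 0 := by omega
    subst this
    simp only [range_zero, sum_empty, neg_zero, pow_zero, mul_one] at heq
    exact hc heq
  have hpow : ‖t‖ ^ d = ‖t‖ * ‖t‖ ^ (d - 1) := by
    rw [← pow_succ']; congr 1; omega
  rw [hpow, mul_one, pow_one] at hest
  have h2 : ‖c‖ * ‖t‖ ≤ (∑ j ∈ range d, C j) * A :=
    le_of_mul_le_mul_right (a := ‖t‖ ^ (d - 1)) (by rw [mul_assoc]; exact hest) (pow_pos htpos _)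
  have h3 : L * A < ‖t‖ := hlt
  have h4 : ‖c‖ * (L * A) < ‖c‖ * ‖t‖ := mul_lt_mul_of_pos_left h3 hcpos
  have h5 : ‖c‖ * (L * A) = ‖c‖ * A + (∑ j ∈ range d, C j) * A := by
    rw [hL]; field_simp
  linarith [mul_pos hcpos hApos]

end Fibre


/-! ### The fibre function and the tree's `WeierstrassData` on large discs -/

section Weierstrass

variable {d : ℕ} {c : ℂ} (P : Polynomial (MvPolynomial (Fin m) ℂ))

/-- **The fibre function `(w, t) ↦ P_w(t)` is a finite sum of holomorphic monomials**:
`P_w(t) = Σ_{j ≤ deg P} a_j(w) t^j`. [cite: SerreGAGA1956, n° 19 Lemme 8] -/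
theorem eval_map_eval_eq_sum (x : (Fin m → ℂ) × ℂ) :
    (P.map (MvPolynomial.eval x.1)).eval x.2 =
      ∑ j ∈ range (P.natDegree + 1), MvPolynomial.eval x.1 (P.coeff j) * x.2 ^ j := by
  rw [eval_eq_sum_range' (lt_of_le_of_lt natDegree_map_le (Nat.lt_succ_self _))]
  simp only [coeff_map]

/-- **The fibre function `(w, t) ↦ P_w(t)` is holomorphic on `ℂ^m × ℂ`** (a polynomial in all variables).
[cite: SerreGAGA1956, n° 19 Lemme 8] -/
theorem differentiable_fibre :
    Differentiable ℂ fun x : (Fin m → ℂ) × ℂ ↦ (P.map (MvPolynomial.eval x.1)).eval x.2 := by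
  have : (fun x : (Fin m → ℂ) × ℂ ↦ (P.map (MvPolynomial.eval x.1)).eval x.2) =
      fun x ↦ ∑ j ∈ range (P.natDegree + 1), MvPolynomial.eval x.1 (P.coeff j) * x.2 ^ j := by
    funext x; exact eval_map_eval_eq_sum P x
  rw [this]
  refine Differentiable.fun_sum fun j _ ↦ ?_
  exact ((BranchedCoveringSCV.differentiable_eval (P.coeff j)).comp differentiable_fst).mul
    (differentiable_snd.pow j)

/-- **Standing hypotheses on a large disc**: with `L` a root bound (`exists_norm_root_le`) and
`r₀ = L (2 + |w₀|) + 1`, the family `P_w` is zero-free on the circle `|t| = r₀` for `|w - w₀| < 1`, i.e. the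
tree's `WeierstrassData` holds for the fibre function on `ball w₀ 1 × ball 0 (r₀ + 1)`. [cite: Chirka1989, §1.1] -/
theorem weierstrassData_fibre {L : ℝ} (hL : 1 ≤ L)
    (hroot : ∀ (w : Fin m → ℂ) (t : ℂ), (P.map (MvPolynomial.eval w)).IsRoot t → ‖t‖ ≤ L * (1 + ‖w‖))
    (w₀ : Fin m → ℂ) :
    WeierstrassData (fun x : (Fin m → ℂ) × ℂ ↦ (P.map (MvPolynomial.eval x.1)).eval x.2) (ball w₀ 1) 0
      (L * (2 + ‖w₀‖) + 1) (L * (2 + ‖w₀‖) + 2) where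
  isOpen := isOpen_ball
  pos := by positivity
  lt := by linarith
  differentiableOn := (differentiable_fibre P).differentiableOn
  ne_zero := by
    intro w hw t ht h0
    have h1 := hroot w t h0
    rw [mem_sphere, dist_zero_right] at ht
    rw [mem_ball, dist_eq_norm] at hw
    have h2 : ‖w‖ ≤ ‖w₀‖ + 1 := by
      have := norm_sub_norm_le w w₀
      linarith
    have h3 : L * (1 + ‖w‖) ≤ L * (2 + ‖w₀‖) := mul_le_mul_of_nonneg_left (by linarith) (by linarith)
    linarith

/-- **All roots lie in the large disc**: for `|w - w₀| < 1` every root of `P_w` has `|t| < r₀`. [cite: SerreGAGA1956, n° 19 Lemme 8] -/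
theorem norm_root_lt {L : ℝ} (hL : 1 ≤ L)
    (hroot : ∀ (w : Fin m → ℂ) (t : ℂ), (P.map (MvPolynomial.eval w)).IsRoot t → ‖t‖ ≤ L * (1 + ‖w‖))
    {w₀ w : Fin m → ℂ} (hw : w ∈ ball w₀ 1) {t : ℂ} (ht : (P.map (MvPolynomial.eval w)).IsRoot t) :
    ‖t‖ < L * (2 + ‖w₀‖) + 1 := by
  have h1 := hroot w t ht
  rw [mem_ball, dist_eq_norm] at hw
  have h2 : ‖w‖ ≤ ‖w₀‖ + 1 := by
    have := norm_sub_norm_le w w₀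
    linarith
  have h3 : L * (1 + ‖w‖) ≤ L * (2 + ‖w₀‖) := mul_le_mul_of_nonneg_left (by linarith) (by linarith)
  linarith

/-- **The order of vanishing of `t ↦ P_w(t)` at `ρ` is the multiplicity of `ρ` as a root of `P_w`**
(`P_w(t) = c ∏ (t - ρ')`). [cite: Chirka1989, §1.1] -/
theorem analyticOrderAt_fibre (hc : c ≠ 0) (hPd : P.natDegree ≤ d) (hPlead : P.coeff d = MvPolynomial.C c)
    (w : Fin m → ℂ) (ρ : ℂ) :
    analyticOrderAt (fun t ↦ (P.map (MvPolynomial.eval w)).eval t) ρ = (P.map (MvPolynomial.eval w)).roots.count ρ := by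
  have hfun : (fun t ↦ (P.map (MvPolynomial.eval w)).eval t) =
      (fun _ : ℂ ↦ c) * fun t ↦ ((P.map (MvPolynomial.eval w)).roots.map fun ρ' ↦ t - ρ').prod := by
    funext t
    rw [Pi.mul_apply, eval_map_eval_eq_prod P hc hPd hPlead w t]
  rw [hfun, analyticOrderAt_mul analyticAt_const, analyticOrderAt_multisetProd_sub,
    analyticAt_const.analyticOrderAt_eq_zero.mpr hc, zero_add]
  exact (differentiable_multisetProd_sub _).analyticAt ρ

/-- **The roots counted by the large disc are all the roots**: `sliceRoots = P_w.roots` as multisets, for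
`|w - w₀| < 1`. [cite: Chirka1989, §1.1] -/
theorem sliceRoots_fibre_eq_roots (hc : c ≠ 0) (hPd : P.natDegree ≤ d) (hPlead : P.coeff d = MvPolynomial.C c)
    {L : ℝ} (hL : 1 ≤ L)
    (hroot : ∀ (w : Fin m → ℂ) (t : ℂ), (P.map (MvPolynomial.eval w)).IsRoot t → ‖t‖ ≤ L * (1 + ‖w‖))
    {w₀ w : Fin m → ℂ} (hw : w ∈ ball w₀ 1) :
    sliceRoots (fun x : (Fin m → ℂ) × ℂ ↦ (P.map (MvPolynomial.eval x.1)).eval x.2) 0 (L * (2 + ‖w₀‖) + 1) w =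
      (P.map (MvPolynomial.eval w)).roots := by
  classical
  set hW := weierstrassData_fibre P hL hroot w₀
  set p := P.map (MvPolynomial.eval w) with hp
  have hg : DifferentiableOn ℂ (fun t ↦ p.eval t) (ball (0 : ℂ) (L * (2 + ‖w₀‖) + 2)) :=
    (p.differentiable_aeval).differentiableOn
  ext ρ
  simp only [sliceRoots]
  by_cases hρ : ρ ∈ ball (0 : ℂ) (L * (2 + ‖w₀‖) + 1)
  · rw [count_rootMultiset_of_mem_ball hg hW.pos hW.lt (hW.ne_zero w hw) hρ, analyticOrderNatAt,
      analyticOrderAt_fibre P hc hPd hPlead w ρ, ENat.toNat_coe]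
  · rw [Multiset.count_eq_zero_of_notMem (fun hmem ↦ hρ (mem_ball_of_mem_rootMultiset hmem)),
      Multiset.count_eq_zero_of_notMem]
    intro hmem
    apply hρ
    rw [mem_ball, dist_zero_right]
    exact norm_root_lt P hL hroot hw ((mem_roots (map_eval_ne_zero P hc hPlead w)).mp hmem)

end Weierstrass



section FibreCorrected

variable {d : ℕ} {c : ℂ} (P : Polynomial (MvPolynomial (Fin m) ℂ))

/-- **Bound for the roots of the fibres** (usable form of `exists_norm_root_le`, whose coefficient hypothesis
`deg a_j + j ≤ d` for ALL `j` cannot be met for `j > d`; here the hypothesis is `deg a_j ≤ d - j`, which holds for the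
family of a polynomial of total degree `≤ d`): every root `t` of `P_w` satisfies `|t| ≤ L (1 + |w|)`.
[cite: SerreGAGA1956, n° 19 Lemme 8] -/
theorem exists_norm_root_le' (hc : c ≠ 0) (hPd : P.natDegree ≤ d) (hPlead : P.coeff d = MvPolynomial.C c)
    (hPcoef : ∀ j, (P.coeff j).totalDegree ≤ d - j) :
    ∃ L : ℝ, 1 ≤ L ∧ ∀ (w : Fin m → ℂ) (t : ℂ), (P.map (MvPolynomial.eval w)).IsRoot t → ‖t‖ ≤ L * (1 + ‖w‖) := by
  classical
  -- coefficient bounds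
  have hC : ∀ j, ∃ C : ℝ, 0 ≤ C ∧ ∀ w : Fin m → ℂ,
      ‖MvPolynomial.eval w (P.coeff j)‖ ≤ C * (1 + ‖w‖) ^ (d - j) := fun j ↦
    norm_eval_le_of_totalDegree_le (P.coeff j) (hPcoef j)
  choose C hC0 hC using hC
  set L : ℝ := 1 + (∑ j ∈ range d, C j) / ‖c‖ with hL
  have hcpos : 0 < ‖c‖ := norm_pos_iff.mpr hc
  have hL1 : 1 ≤ L := by rw [hL]; exact le_add_of_nonneg_right (div_nonneg (sum_nonneg fun j _ ↦ hC0 j) hcpos.le)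
  refine ⟨L, hL1, fun w t ht ↦ ?_⟩
  by_contra hlt
  push Not at hlt
  set A : ℝ := 1 + ‖w‖ with hA
  have hA1 : 1 ≤ A := by rw [hA]; linarith [norm_nonneg w]
  have hApos : 0 < A := by linarith
  have htpos : 0 < ‖t‖ := lt_of_le_of_lt (by positivity) hlt
  have hAt : A ≤ ‖t‖ := le_trans (by nlinarith) hlt.le
  -- the equation `c t^d = - Σ_{j<d} a_j t^j`
  have hroot : (P.map (MvPolynomial.eval w)).eval t = 0 := ht
  rw [eval_eq_sum_range' (lt_of_le_of_lt (natDegree_map_eval_le P hPd w) (Nat.lt_succ_self d)),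
    sum_range_succ, coeff_map_eval_eq P hPlead w] at hroot
  have heq : c * t ^ d = -∑ j ∈ range d, (P.map (MvPolynomial.eval w)).coeff j * t ^ j :=
    eq_neg_of_add_eq_zero_right hroot
  -- estimate the right side
  have hest : ‖c‖ * ‖t‖ ^ d ≤ (∑ j ∈ range d, C j) * A ^ 1 * ‖t‖ ^ (d - 1) * 1 := by
    have h1 : ‖c * t ^ d‖ ≤ ∑ j ∈ range d, C j * A ^ (d - j) * ‖t‖ ^ j := by
      rw [heq, norm_neg]
      refine (norm_sum_le _ _).trans (sum_le_sum fun j hj ↦ ?_)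
      rw [norm_mul, norm_pow, coeff_map]
      exact mul_le_mul_of_nonneg_right (hC j w) (by positivity)
    rw [norm_mul, norm_pow] at h1
    refine h1.trans ?_
    rw [mul_one, pow_one, sum_mul, sum_mul]
    refine sum_le_sum fun j hj ↦ ?_
    have hjd : j < d := Finset.mem_range.mp hj
    -- `A^{d-j} |t|^j ≤ A |t|^{d-1}` since `A ≤ |t|`
    have key : A ^ (d - j) * ‖t‖ ^ j ≤ A * ‖t‖ ^ (d - 1) := by
      have e1 : A ^ (d - j) = A * A ^ (d - j - 1) := by
        rw [← pow_succ']; congr 1; omega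
      rw [e1, mul_assoc]
      refine mul_le_mul_of_nonneg_left ?_ hApos.le
      calc A ^ (d - j - 1) * ‖t‖ ^ j ≤ ‖t‖ ^ (d - j - 1) * ‖t‖ ^ j :=
            mul_le_mul_of_nonneg_right (pow_le_pow_left₀ hApos.le hAt _) (by positivity)
        _ = ‖t‖ ^ (d - 1) := by rw [← pow_add]; congr 1; omega
    calc C j * A ^ (d - j) * ‖t‖ ^ j = C j * (A ^ (d - j) * ‖t‖ ^ j) := by ring
      _ ≤ C j * (A * ‖t‖ ^ (d - 1)) := mul_le_mul_of_nonneg_left key (hC0 j)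
      _ = C j * A * ‖t‖ ^ (d - 1) := by ring
  -- but `|t| ≥ L A > (Σ C_j / |c|) A`
  have hd0 : 0 < d := by
    by_contra hd0
    have : d = 0 := by omega
    subst this
    simp only [range_zero, sum_empty, neg_zero, pow_zero, mul_one] at heq
    exact hc heq
  have hpow : ‖t‖ ^ d = ‖t‖ * ‖t‖ ^ (d - 1) := by
    rw [← pow_succ']; congr 1; omega
  rw [hpow, mul_one, pow_one] at hest
  have h2 : ‖c‖ * ‖t‖ ≤ (∑ j ∈ range d, C j) * A :=
    le_of_mul_le_mul_right (a := ‖t‖ ^ (d - 1)) (by rw [mul_assoc]; exact hest) (pow_pos htpos _)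
  have h3 : L * A < ‖t‖ := hlt
  have h4 : ‖c‖ * (L * A) < ‖c‖ * ‖t‖ := mul_lt_mul_of_pos_left h3 hcpos
  have h5 : ‖c‖ * (L * A) = ‖c‖ * A + (∑ j ∈ range d, C j) * A := by
    rw [hL]; field_simp
  linarith [mul_pos hcpos hApos]


end FibreCorrected

end AffineHypersurface

end Literature.Analysis.Complex
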